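import Literature.Topology.FourManifolds.PlanarLevelTwist
import HarnessLib

/-!
# The level-curve flow of a proper pair of first integrals on `ℝ³`, with smooth period functions

Topic `Literature/Topology/FourManifolds`; generic form of `PlanarLevelTwist.exists_planarLevelPackage`
(there `H = (q ∘ π, z)`), for an ARBITRARY smooth proper pair of first integrals
`H = (H₁, H₂) : ℝ³ → ℝ²` — in the sequel `ThickenSurfaceTwist.lean`, `H = (f, q ∘ π + z²)` for a
smooth `f`, whose level curves on the boundary surface `{q ∘ π + z² = c}` of a thickened planar
handlebody are the curves `{f = a}`: meridians (`f = y`), chain curves (`f = x² + y²`) and hole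
circles (`f = z`) of the flower surfaces of the Dehn–Nielsen–Baer seat (`DehnNielsenBaerSurface.lean`).

Given: `H` smooth with compact preimages of compact boxes; a box of values
`(s₁ - δ, s₂ + δ) × (h₁ - δ, h₂ + δ)` on whose preimage `DH` is onto; a smooth map `σ : ℝ² → ℝ³`
which is a section of `H` over that box; `s₀ ∈ [s₁, s₂] × [h₁, h₂]`.  We construct
(`exists_boxLevelPackage`): a smooth cut-off `ψ`, `= 1` on the preimage of the `δ`-box and `= 0`
off that of the `2δ`-box; the smooth complete flow `θ` of `ℝ³` whose integral curves have velocity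
`twistField bE3 bF2 H ψ = ψ · v_H` (`v_H` the tangent field of the level curves of `H`,
`LevelSetTwistField.lean`), preserving `H` and fixing `{ψ = 0}` pointwise; ONE positive period of the
(compact, regular) level curve through `σ s₀`; and for EVERY positive period `T₀` of it a smooth
positive period function `P` on an open `S ∋ s₀` inside the `δ`-box with `P s₀ = T₀`,
`θ(P s, σ s) = σ s`, the family `flowSaturation θ σ S` of curves through `σ(S)` being open.

Everything is proved; no definitions, no named facts (D-0026).

## References

* B. Farb, D. Margalit, *A primer on mapping class groups*, PMS 49 (2012), §3.1.1.
  [FarbMargalit2012]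
* J. Milnor, *Topology from the Differentiable Viewpoint* (1965), §2 Lemma 1. [MilnorTDV1965]
-/

open scoped Manifold ContDiff Topology
open Set Function Filter Metric

noncomputable section

namespace Literature.Topology.FourManifolds

open PlanarThickening Literature.Geometry.Manifold

/-- Local notation: `𝔼 n` is the model Euclidean space `EuclideanSpace ℝ (Fin n)`. -/
local notation "𝔼 " n:arg => EuclideanSpace ℝ (Fin n)

namespace PlanarLevelTwist

/-- **The level-curve flow of a proper pair of first integrals on `ℝ³` with its smooth period
functions** (see the file header). [cite: FarbMargalit2012, §3.1.1] [cite: MilnorTDV1965, §2 Lemma 1] -/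
theorem exists_boxLevelPackage {H : 𝔼 3 → ℝ × ℝ} (hH : ContDiff ℝ ∞ H)
    (hprop : ∀ a b a' b' : ℝ, IsCompact (H ⁻¹' (Icc a b ×ˢ Icc a' b')))
    {s₁ s₂ h₁ h₂ δ : ℝ} (hδ : 0 < δ)
    (hreg : ∀ x, H x ∈ Ioo (s₁ - δ) (s₂ + δ) ×ˢ Ioo (h₁ - δ) (h₂ + δ) →
      LinearMap.range (fderiv ℝ H x : 𝔼 3 →ₗ[ℝ] ℝ × ℝ) = ⊤)
    {σ : ℝ × ℝ → 𝔼 3} (hσ : ContDiff ℝ ∞ σ)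
    (hHσ : ∀ s ∈ Ioo (s₁ - δ) (s₂ + δ) ×ˢ Ioo (h₁ - δ) (h₂ + δ), H (σ s) = s)
    {s₀ : ℝ × ℝ} (hs₀ : s₀ ∈ Icc s₁ s₂ ×ˢ Icc h₁ h₂) :
    ∃ (ψ : 𝔼 3 → ℝ) (θ : ℝ × 𝔼 3 → 𝔼 3), ContDiff ℝ ∞ ψ ∧
      (∀ x, H x ∈ Ioo (s₁ - δ) (s₂ + δ) ×ˢ Ioo (h₁ - δ) (h₂ + δ) → ψ x = 1) ∧
      (∀ x, H x ∉ Ioo (s₁ - 2 * δ) (s₂ + 2 * δ) ×ˢ Ioo (h₁ - 2 * δ) (h₂ + 2 * δ) → ψ x = 0) ∧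
      ContDiff ℝ ∞ θ ∧ (∀ x, θ (0, x) = x) ∧ (∀ t s x, θ (t, θ (s, x)) = θ (t + s, x)) ∧
      (∀ x t, HasDerivAt (fun t => θ (t, x)) (twistField bE3 bF2 H ψ (θ (t, x))) t) ∧
      (∀ t x, H (θ (t, x)) = H x) ∧
      (∀ x, ψ x = 0 → ∀ t, θ (t, x) = x) ∧
      (∃ T₀ : ℝ, 0 < T₀ ∧ θ (T₀, σ s₀) = σ s₀) ∧
      ∀ T₀ : ℝ, 0 < T₀ → θ (T₀, σ s₀) = σ s₀ →
        ∃ (P : ℝ × ℝ → ℝ) (S : Set (ℝ × ℝ)), IsOpen S ∧ s₀ ∈ S ∧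
          S ⊆ Ioo (s₁ - δ) (s₂ + δ) ×ˢ Ioo (h₁ - δ) (h₂ + δ) ∧ ContDiffOn ℝ ∞ P S ∧
          P s₀ = T₀ ∧ (∀ s ∈ S, 0 < P s) ∧ (∀ s ∈ S, θ (P s, σ s) = σ s) ∧
          IsOpen (flowSaturation θ σ S) := by
  -- the plateaus and the cut-off
  obtain ⟨χ, hχs, -, hχ1, hχsupp⟩ := exists_plateau (a := s₁) (b := s₂) hδ
  obtain ⟨χ', hχ's, -, hχ'1, hχ'supp⟩ := exists_plateau (a := h₁) (b := h₂) hδ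
  set ψ : 𝔼 3 → ℝ := fun x => χ (H x).1 * χ' (H x).2 with hψdef
  have hψs : ContDiff ℝ ∞ ψ :=
    (hχs.comp (contDiff_fst.comp hH)).mul (hχ's.comp (contDiff_snd.comp hH))
  have hψzero : ∀ x, H x ∉ Ioo (s₁ - 2 * δ) (s₂ + 2 * δ) ×ˢ Ioo (h₁ - 2 * δ) (h₂ + 2 * δ) →
      ψ x = 0 := by
    intro x hx
    by_cases h1 : χ (H x).1 = 0
    · simp [hψdef, h1]
    · have h2 : χ' (H x).2 = 0 := by
        by_contra h2
        exact hx ⟨hχsupp _ h1, hχ'supp _ h2⟩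
      simp [hψdef, h2]
  -- compact support
  set K : Set (𝔼 3) := H ⁻¹' (Icc (s₁ - 2 * δ) (s₂ + 2 * δ) ×ˢ Icc (h₁ - 2 * δ) (h₂ + 2 * δ))
    with hKdef
  have hKc : IsCompact K := hprop _ _ _ _
  have hψK : ∀ x, x ∉ K → ψ x = 0 := by
    intro x hx
    apply hψzero
    intro hcon
    exact hx ⟨⟨hcon.1.1.le, hcon.1.2.le⟩, ⟨hcon.2.1.le, hcon.2.2.le⟩⟩
  -- the open set `U` on which `ψ = 1`, and regularity there
  set U : Set (𝔼 3) := H ⁻¹' (Ioo (s₁ - δ) (s₂ + δ) ×ˢ Ioo (h₁ - δ) (h₂ + δ)) with hUdef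
  have hUo : IsOpen U := (isOpen_Ioo.prod isOpen_Ioo).preimage hH.continuous
  have hψU : ∀ x ∈ U, ψ x = 1 := by
    intro x hx
    simp only [hUdef, mem_preimage, mem_prod, mem_Ioo] at hx
    simp only [hψdef]
    rw [hχ1 _ ⟨hx.1.1.le, hx.1.2.le⟩, hχ'1 _ ⟨hx.2.1.le, hx.2.2.le⟩, mul_one]
  have hregU : ∀ x ∈ U, H x = s₀ → LinearMap.range (fderiv ℝ H x : 𝔼 3 →ₗ[ℝ] ℝ × ℝ) = ⊤ :=
    fun x hx _ => hreg x hx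
  -- the section
  set J : Set (ℝ × ℝ) := Ioo (s₁ - δ) (s₂ + δ) ×ˢ Ioo (h₁ - δ) (h₂ + δ) with hJdef
  have hJo : IsOpen J := isOpen_Ioo.prod isOpen_Ioo
  have hs₀J : s₀ ∈ J :=
    ⟨⟨by linarith [hs₀.1.1], by linarith [hs₀.1.2]⟩, ⟨by linarith [hs₀.2.1], by linarith [hs₀.2.2]⟩⟩
  have hσU : ∀ s ∈ J, σ s ∈ U := by
    intro s hs
    show H (σ s) ∈ Ioo (s₁ - δ) (s₂ + δ) ×ˢ Ioo (h₁ - δ) (h₂ + δ)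
    rw [hHσ s hs]; exact hs
  have hψσ : ∀ s ∈ J, ψ (σ s) ≠ 0 := fun s hs => by rw [hψU _ (hσU s hs)]; exact one_ne_zero
  have hregσ : ∀ s ∈ J, LinearMap.range (fderiv ℝ H (σ s) : 𝔼 3 →ₗ[ℝ] ℝ × ℝ) = ⊤ :=
    fun s hs => hreg _ (hσU s hs)
  -- compactness of the level component
  have hcpt : IsCompact (connectedComponentIn (U ∩ H ⁻¹' {s₀}) (σ s₀)) := by
    have hL : IsCompact (U ∩ H ⁻¹' {s₀}) := by
      have hsub : U ∩ H ⁻¹' {s₀} = H ⁻¹' (Icc s₀.1 s₀.1 ×ˢ Icc s₀.2 s₀.2) := by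
        ext x
        simp only [mem_inter_iff, mem_preimage, mem_singleton_iff, Icc_self, mem_prod,
          mem_singleton_iff]
        constructor
        · rintro ⟨-, hx⟩; rw [hx]; exact ⟨rfl, rfl⟩
        · rintro ⟨h1, h2⟩
          have hx : H x = s₀ := Prod.ext h1 h2
          refine ⟨?_, hx⟩
          show H x ∈ Ioo (s₁ - δ) (s₂ + δ) ×ˢ Ioo (h₁ - δ) (h₂ + δ)
          rw [hx]; exact hs₀J
      rw [hsub]
      exact hprop _ _ _ _
    have hzL : σ s₀ ∈ U ∩ H ⁻¹' {s₀} :=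
      ⟨hσU _ hs₀J, by simp only [mem_preimage, mem_singleton_iff]; exact hHσ _ hs₀J⟩
    haveI : CompactSpace (U ∩ H ⁻¹' {s₀} : Set (𝔼 3)) := isCompact_iff_compactSpace.1 hL
    rw [connectedComponentIn_eq_image hzL]
    exact (isClosed_connectedComponent.isCompact).image continuous_subtype_val
  -- the flow, the velocity along the section, one period, the period functions
  obtain ⟨θ, hθ, h0, hadd, hint, hfix, hHinv, hψfix⟩ :=
    exists_levelFlow (bE := bE3) (bF := bF2) hH hψs hKc hψK
  have hvel : ∀ u : ℝ, ∀ s ∈ J, ∃ v : 𝔼 3, v ≠ 0 ∧ HasDerivAt (fun t => θ (t, σ s)) v u :=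
    exists_velocity_ne_zero h0 hadd hfix hint fun s hs => twistField_ne_zero (hψσ s hs) (hregσ s hs)
  obtain ⟨T₁, hT₁, hT₁per⟩ :=
    exists_pos_period_of_isCompact_connectedComponentIn (bE := bE3) (bF := bF2)
      hH hψs h0 hadd hint hUo hψU hregU (hσU _ hs₀J) (hHσ _ hs₀J) hcpt
  refine ⟨ψ, θ, hψs, fun x hx => hψU x hx, hψzero, hθ, h0, hadd, hint, hHinv, hψfix,
    ⟨T₁, hT₁, hT₁per⟩, fun T₀ hT₀ hT => ?_⟩
  obtain ⟨P, S, hSo, hs₀S, hSJ, hPs, hP0, hPpos, -, hPS, hopen, -⟩ :=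
    exists_period_package (finrank_eq_of_bases bE3 bF2) hθ h0 hadd hH hHinv hσ hJo hs₀J hHσ hT₀
      hT hvel
  exact ⟨P, S, hSo, hs₀S, hSJ, hPs, hP0, hPpos, hPS, hopen⟩

end PlanarLevelTwist

end Literature.Topology.FourManifolds

end
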